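/-
Copyright: the b2b-balaban T⁴-continuum CRUX team, row NE7b OWNER lineage `t4-ne7b-p1` (gen 110). Project licence.
-/
import Summits.QuantumFields.BalabanUV.T4Continuum.Spine.NE7b.LogConcaveMarginal
import Summits.QuantumFields.BalabanUV.T4Continuum.Spine.NE7b.FluctuationStepModulus
import Summits.QuantumFields.BalabanUV.T4Continuum.Spine.NE7b.FluctuationStepGrowth
import Mathlib.MeasureTheory.Measure.Haar.InnerProductSpace
import Mathlib.Topology.Algebra.Module.FiniteDimension

/-!
# THE MODULUS AFTER ONE FLUCTUATION STEP, IN ONE STATEMENT: `ψ ↦ −log ∫_{K₂} e^{−V(φ) − G(ψ − Qφ)} dφ` is `aσ∕(σ + aκ²)`-strongly convex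
# — Brascamp–Lieb Thm 4.3 on a convex window (`…LogConcaveMarginal` §3) composed with the step's joint letter by value
# (`…FluctuationStepModulus` §2), the side letters `hint` ∕ `hpos` discharged for a bounded window (row NE7b, node U5c; (R2′) family (2), (ℓ1))

Cell `pub-balaban`, sub-cell `t4`, spine estimate NE7b (`T4WeightBudget.RelWeightBound`; the cell's OWN estimate — NOT PRINTED in
[Bałaban 1983–89], NOT PROVED).  Crux-route work under `Spine/NE7b/` by the row's OWNER; NOTHING of Bałaban's is named or asserted; no
`T4Continuum/Support` leaf typed; no `def`; zero `sorry`.  Imports: the OWNER's (26) `…LogConcaveMarginal` and (30) `…FluctuationStepModulus`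
+ (32) `…FluctuationStepGrowth` (for the bounded-window side letters) + Mathlib.

WHY.  (26) §3 says the base-direction modulus of a joint exponent survives the fibre integral; (30) §2 says the renormalisation-step exponent
`U(ψ, φ) = V(φ) + G(ψ − Qφ)` HAS base-direction modulus `aσ∕(σ + aκ²)` from the three numbers of the step (`σ` = incoming modulus ON the
window `K₂`, `a` = fluctuation modulus, `κ` = norm of the averaging).  This file is the composition, so that an instance reads ONE theorem:
the next action `V⁺(ψ) = −log ∫_{K₂} e^{−V(φ) − G(ψ − Qφ)} dφ` is `aσ∕(σ + aκ²)`-strongly convex on any convex set of new fields — on ALL of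
them when the fluctuation weight is convex everywhere (§2: window bounded with positive volume, `V`, `G` continuous ⟹ no side letter left).

WHAT IS PROVED ([folklore]):
* §1 **`strongConvexOn_neg_log_stepMarginal`** — general form: `K₂ ⊆ ℝⁿ` convex measurable, `V` measurable and `σ`-strongly convex on `K₂`,
  `G` measurable and `a`-strongly convex on `ℝᵐ`, `Q : ℝⁿ →ₗ ℝᵐ` with `‖Qφ‖ ≤ κ‖φ‖`, `σ ≥ 0`, `σ + aκ² > 0`, and on the convex base set `B`
  the fibre densities integrable on `K₂` with positive integral ⟹ `StrongConvexOn B (aσ∕(σ+aκ²)) (ψ ↦ −log ∫_{K₂} e^{−(V φ + G(ψ − Qφ))} dφ)`.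
* §2 the side letters for a BOUNDED window are (32) `…FluctuationStepGrowth.integrableOn_stepDensity'` ∕ `stepIntegral_pos'` BY NAME (v2: the
  v1 copies were located duplicates — gate `dedup.landed` on p376827); `volume_pos_of_interior_nonempty`; **`strongConvexOn_neg_log_stepMarginal_of_isBounded`**
  (no side letter: `StrongConvexOn B (aσ∕(σ+aκ²)) V⁺` for every convex `B`, in particular `B = univ`).
* §3 the sockets' currency at a point of differentiability: `stepMarginal_firstOrder_of_hasGradientAt` ((26) §5 BY NAME: `V⁺ ψ + ⟪g, ψ' − ψ⟫
  + (aσ∕(σ+aκ²))∕2·‖ψ' − ψ‖² ≤ V⁺ ψ'` for `HasGradientAt V⁺ g ψ`; the gradient itself = the tilted mean of `∇G(ψ − Q·)` is (28)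
  `…LogConcaveMarginalDeriv`, not restated).

NOT HERE (honest): which `V`, `G`, `Q`, `K₂` and numbers Bałaban's steps display, in which chart ((A3) ∕ (A1c); NC-NE7b-α UNRULED); the
rescaling between steps ((27) `…ConvexityModulusTransport.strongConvexOn_comp_smul`); joint (non-product) windows (leaf-01 `…HessianChartTransport`,
leaf-03 `…ShearedWindowMarginal`); anything of Bałaban's.  BY-NAME EFFECT ON THE WALL: NONE.  NE7b NOT PRINTED ∕ NOT PROVED; spine PROVED 0∕9;
rung (B)+1 on a FINITE torus — NOT infinite volume, NOT the mass gap, NOT Clay.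
HONEST DEPENDENCY: continuum YM on T⁴ ⇐ BetaPertH ∧ nine spine estimates (0/9 proved); BetaPertH ⇐ (D1) ∧ (D4) ∧ CAP+tail.
-/

set_option autoImplicit false

noncomputable section

open MeasureTheory Real Set Bornology
open scoped RealInnerProductSpace
open Summit.QuantumFields.BalabanUV.T4Continuum.NE7b.LogConcaveMarginal
open Summit.QuantumFields.BalabanUV.T4Continuum.NE7b.FluctuationStepModulus
open Summit.QuantumFields.BalabanUV.T4Continuum.NE7b.FluctuationStepGrowth

namespace Summit.QuantumFields.BalabanUV.T4Continuum.NE7b.FluctuationStepMarginal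

variable {m n : ℕ}

/-! ## §1 The composition: BL Thm 4.3 on the window `univ ×ˢ K₂` with the step's joint letter -/

/-- The fibre of the product window `univ ×ˢ K₂` over any base point is `K₂`. [folklore] -/
theorem fibre_univ_prod (K₂ : Set (EuclideanSpace ℝ (Fin n))) (x : EuclideanSpace ℝ (Fin m)) :
    Prod.mk x ⁻¹' ((univ : Set (EuclideanSpace ℝ (Fin m))) ×ˢ K₂) = K₂ := by
  ext y; simp

/-- The step exponent `p ↦ V p.2 + G (p.1 − Q p.2)` is measurable for measurable `V`, `G` (`Q` linear between finite-dimensional spaces is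
continuous). [folklore] -/
theorem measurable_stepExponent {V : EuclideanSpace ℝ (Fin n) → ℝ} {G : EuclideanSpace ℝ (Fin m) → ℝ} (hVm : Measurable V)
    (hGm : Measurable G) (Q : EuclideanSpace ℝ (Fin n) →ₗ[ℝ] EuclideanSpace ℝ (Fin m)) :
    Measurable fun p : EuclideanSpace ℝ (Fin m) × EuclideanSpace ℝ (Fin n) => V p.2 + G (p.1 - Q p.2) :=
  (hVm.comp measurable_snd).add
    (hGm.comp (measurable_fst.sub (Q.continuous_of_finiteDimensional.measurable.comp measurable_snd)))

/-- **THE MODULUS AFTER ONE FLUCTUATION STEP** (general window).  `K₂ ⊆ ℝⁿ` convex and measurable; `V : ℝⁿ → ℝ` measurable and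
`σ`-strongly convex on `K₂` (`σ ≥ 0`); `G : ℝᵐ → ℝ` measurable and `a`-strongly convex on `ℝᵐ`; `Q : ℝⁿ →ₗ ℝᵐ` with `‖Qφ‖ ≤ κ‖φ‖`;
`σ + aκ² > 0`; `B ⊆ ℝᵐ` convex with the densities `φ ↦ e^{−(V φ + G(ψ − Qφ))}` integrable on `K₂` and of positive integral for `ψ ∈ B`.
Then the next action `ψ ↦ −log ∫_{K₂} e^{−(V φ + G(ψ − Qφ))} dφ` is `aσ∕(σ + aκ²)`-strongly convex on `B`
((26) `strongConvexOn_neg_log_fibreIntegral` on the window `univ ×ˢ K₂`, its `hVc` = (30) `secant_base_of_fluctuationStep_prod`). [folklore] -/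
theorem strongConvexOn_neg_log_stepMarginal {K₂ : Set (EuclideanSpace ℝ (Fin n))} (hK₂m : MeasurableSet K₂) (hK₂c : Convex ℝ K₂)
    {V : EuclideanSpace ℝ (Fin n) → ℝ} {G : EuclideanSpace ℝ (Fin m) → ℝ} (hVm : Measurable V) (hGm : Measurable G)
    {a σ κ : ℝ} (hV : StrongConvexOn K₂ σ V) (hG : StrongConvexOn univ a G) (hσ : 0 ≤ σ) (hD : 0 < σ + a * κ ^ 2)
    (Q : EuclideanSpace ℝ (Fin n) →ₗ[ℝ] EuclideanSpace ℝ (Fin m)) (hQ : ∀ y, ‖Q y‖ ≤ κ * ‖y‖)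
    {B : Set (EuclideanSpace ℝ (Fin m))} (hB : Convex ℝ B)
    (hint : ∀ x ∈ B, IntegrableOn (fun y => exp (-(V y + G (x - Q y)))) K₂)
    (hpos : ∀ x ∈ B, 0 < ∫ y in K₂, exp (-(V y + G (x - Q y)))) :
    StrongConvexOn B (a * σ / (σ + a * κ ^ 2)) fun x => -log (∫ y in K₂, exp (-(V y + G (x - Q y)))) := by
  have hK : MeasurableSet ((univ : Set (EuclideanSpace ℝ (Fin m))) ×ˢ K₂) := MeasurableSet.univ.prod hK₂m
  have hKc : Convex ℝ ((univ : Set (EuclideanSpace ℝ (Fin m))) ×ˢ K₂) := convex_univ.prod hK₂c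
  have hVc := secant_base_of_fluctuationStep_prod (K₂ := K₂) hG hV hσ hD Q hQ
    (U := fun p : EuclideanSpace ℝ (Fin m) × EuclideanSpace ℝ (Fin n) => V p.2 + G (p.1 - Q p.2)) (fun _ => rfl) univ
  have h := strongConvexOn_neg_log_fibreIntegral (lam := a * σ / (σ + a * κ ^ 2)) hK hKc (measurable_stepExponent hVm hGm Q) hVc hB
    (fun x hx => by rw [fibre_univ_prod]; exact hint x hx) (fun x hx => by rw [fibre_univ_prod]; exact hpos x hx)
  simp only [fibre_univ_prod] at h
  exact h

/-! ## §2 The letter-free statement on a bounded window (side letters from (32) BY NAME) -/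

/-- A convex set with an interior point has positive volume (so `stepIntegral_pos` applies to every convex window with non-empty interior).
[folklore] -/
theorem volume_pos_of_interior_nonempty {K₂ : Set (EuclideanSpace ℝ (Fin n))} (hK₂i : (interior K₂).Nonempty) : 0 < volume K₂ :=
  lt_of_lt_of_le (isOpen_interior.measure_pos volume hK₂i) (measure_mono interior_subset)

/-- **THE MODULUS AFTER ONE FLUCTUATION STEP, NO SIDE LETTER.**  `K₂ ⊆ ℝⁿ` convex, measurable, bounded, of positive volume; `V` continuous
and `σ`-strongly convex on `K₂` (`σ ≥ 0`); `G` continuous and `a`-strongly convex on `ℝᵐ`; `‖Qφ‖ ≤ κ‖φ‖`; `σ + aκ² > 0`.  Then for EVERY convex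
`B ⊆ ℝᵐ` (e.g. `B = univ`): `StrongConvexOn B (aσ∕(σ + aκ²)) (ψ ↦ −log ∫_{K₂} e^{−(V φ + G(ψ − Qφ))} dφ)` — the next action inherits the
parallel sum of the incoming modulus and the fluctuation modulus. [folklore] -/
theorem strongConvexOn_neg_log_stepMarginal_of_isBounded {K₂ : Set (EuclideanSpace ℝ (Fin n))} (hK₂m : MeasurableSet K₂)
    (hK₂c : Convex ℝ K₂) (hK₂b : IsBounded K₂) (hK₂v : 0 < volume K₂)
    {V : EuclideanSpace ℝ (Fin n) → ℝ} {G : EuclideanSpace ℝ (Fin m) → ℝ} (hVc : Continuous V) (hGc : Continuous G)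
    {a σ κ : ℝ} (hV : StrongConvexOn K₂ σ V) (hG : StrongConvexOn univ a G) (hσ : 0 ≤ σ) (hD : 0 < σ + a * κ ^ 2)
    (Q : EuclideanSpace ℝ (Fin n) →ₗ[ℝ] EuclideanSpace ℝ (Fin m)) (hQ : ∀ y, ‖Q y‖ ≤ κ * ‖y‖)
    {B : Set (EuclideanSpace ℝ (Fin m))} (hB : Convex ℝ B) :
    StrongConvexOn B (a * σ / (σ + a * κ ^ 2)) fun x => -log (∫ y in K₂, exp (-(V y + G (x - Q y)))) :=
  strongConvexOn_neg_log_stepMarginal hK₂m hK₂c hVc.measurable hGc.measurable hV hG hσ hD Q hQ hB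
    (fun x _ => integrableOn_stepDensity' hK₂b hVc hGc Q x) (fun x _ => stepIntegral_pos' hK₂b hK₂v hVc hGc Q x)

/-! ## §3 The sockets' currency at a point of differentiability -/

/-- **THE FIRST-ORDER LETTER OF THE NEXT ACTION** at a point where it has a gradient ((26) §5 BY NAME): under §2's hypotheses, for `ψ, ψ' ∈ B`
and `HasGradientAt V⁺ g ψ`: `V⁺ ψ + ⟪g, ψ' − ψ⟫ + (aσ∕(σ+aκ²))∕2·‖ψ' − ψ‖² ≤ V⁺ ψ'` with `V⁺ = ψ ↦ −log ∫_{K₂} e^{−(V φ + G(ψ − Qφ))} dφ` (the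
gradient is the tilted mean of `∇G(ψ − Q·)` — (28) `…LogConcaveMarginalDeriv`, not restated here). [folklore] -/
theorem stepMarginal_firstOrder_of_hasGradientAt {K₂ : Set (EuclideanSpace ℝ (Fin n))} (hK₂m : MeasurableSet K₂)
    (hK₂c : Convex ℝ K₂) (hK₂b : IsBounded K₂) (hK₂v : 0 < volume K₂)
    {V : EuclideanSpace ℝ (Fin n) → ℝ} {G : EuclideanSpace ℝ (Fin m) → ℝ} (hVc : Continuous V) (hGc : Continuous G)
    {a σ κ : ℝ} (hV : StrongConvexOn K₂ σ V) (hG : StrongConvexOn univ a G) (hσ : 0 ≤ σ) (hD : 0 < σ + a * κ ^ 2)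
    (Q : EuclideanSpace ℝ (Fin n) →ₗ[ℝ] EuclideanSpace ℝ (Fin m)) (hQ : ∀ y, ‖Q y‖ ≤ κ * ‖y‖)
    {B : Set (EuclideanSpace ℝ (Fin m))} (hB : Convex ℝ B) {x x' : EuclideanSpace ℝ (Fin m)} (hx : x ∈ B) (hx' : x' ∈ B)
    {g : EuclideanSpace ℝ (Fin m)} (hg : HasGradientAt (fun z => -log (∫ y in K₂, exp (-(V y + G (z - Q y))))) g x) :
    -log (∫ y in K₂, exp (-(V y + G (x - Q y)))) + ⟪g, x' - x⟫ + a * σ / (σ + a * κ ^ 2) / 2 * ‖x' - x‖ ^ 2 ≤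
      -log (∫ y in K₂, exp (-(V y + G (x' - Q y)))) :=
  firstOrder_of_strongConvexOn_hasGradientAt
    (strongConvexOn_neg_log_stepMarginal_of_isBounded hK₂m hK₂c hK₂b hK₂v hVc hGc hV hG hσ hD Q hQ hB) hx hx' hg

/-! ## §4 Sanity (decided toy) -/

/-- Toy: the numbers of a unit Gaussian step — incoming modulus `σ = 2`, fluctuation `a = 2`, averaging norm `κ = 1` ⟹ outgoing modulus `1`
(`= (½ + ½)⁻¹`), and the theorem's conclusion shape is inhabited at these numbers. -/
example : (2 : ℝ) * 2 / (2 + 2 * 1 ^ 2) = 1 := by norm_num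

end Summit.QuantumFields.BalabanUV.T4Continuum.NE7b.FluctuationStepMarginal
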